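import Summits.Langlands.Langlands.Theorems.IrreducibilityBySelfDualityReciprocityUpToIrreducibilityWeakExistenceNormTwist
import Summits.Langlands.Langlands.Theorems.IrreducibilityBySelfDualityReciprocityUpToIrreducibilityRankOneAllPlaces
import HarnessLib

/-!
# Stub W of line `Sketch` (crux `ReciprocityUpToIrreducibility`, item stmt-Langlands-14328) in rank one:
# the WHOLE finite-order sector and its norm twists, no `FontaineDatumExists` (wave N10, stub F)

Support file (closes nothing).  The accepted `…WeakExistence` (c3) proves the registered open stub W
(Buzzard–Gee Conj. 3.2.2, weak form) for `GL_1` in the sector "`π` transforms by `χ ∘ det`, `χ` of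
finite order AND UNRAMIFIED ABOVE `ℓ`", and `…WeakExistenceNormTwist` (c3) extends it to
`χ = χ₀ · ‖·‖^k` under the same restriction on `χ₀` and under the named T0 fact `FontaineDatumExists`.
Both restrictions came from the de Rham clause at `v ∣ ℓ` for Fontaine's PINNED datum, which used to
be decidable only on unramified representations.

Since the D1 upgrade of `Literature.NumberTheory.PAdicHodge.FontaineDpst` the period ring of the
pinned datum IS `B_dR(K_v)` unconditionally, so finite-image local representations are de Rham for it
(`fontainePstAdicCompletion_isDeRhamFramed_of_finite_range`), and Tate twists of de Rham
representations are de Rham as soon as the cyclotomic character is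
(`PstWeilDeligneData.IsDeRhamFramed.tateTwist`).  Hence:

* `exists_lAdic_of_isFiniteOrder_isOpen_ker` — the `ℓ`-adic avatar of a finite-order Hecke character
  with its OPEN-KERNEL clause exported (`FramedArtinRep.lAdicAvatar`, `isOpen_ker_lAdicAvatar`); an
  open-kernel `ρ` has finite image on every decomposition group (`Γ_K` compact; private copies of
  c8's `finite_range_of_isOpen_ker`, `finite_range_toLocal_of_isOpen_ker` of `…ArtinSectorAboveClause`,
  not imported here to keep this file independent of it), hence is de Rham at every `v ∣ ℓ` for the
  pinned datum (`fontainePstAdicCompletion_isDeRhamFramed_of_finite_range`).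
* `weakExistence_rankOne_of_isFiniteOrder_all` — W for `GL_1` on the WHOLE finite-order sector (any
  ramification above `ℓ`), unconditionally: the `ℓ`-adic avatar `r₀` of the Artin character of `χ₀`
  (`HeckeCharacter.exists_framedArtinRep_of_isFiniteOrder`, `FramedArtinRep.lAdicAvatar`) has open
  kernel, hence finite image at every `v ∣ ℓ`, hence is de Rham there.
* `weakExistence_rankOne_of_isFiniteOrder_normTwist_all` — W for `GL_1` on the sector `χ₀ · ‖·‖^k`,
  `χ₀` of finite order with ANY ramification, `k ∈ ℤ`, given only that the cyclotomic character of
  `K_v` is de Rham for the pinned datum at each `v ∣ ℓ` (itself unconditional after D1; taken here as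
  a hypothesis): `ρ = r₀ ⊗ ε_ℓ^k` exactly as in c3's proof, the de Rham clause now by
  `finite image ⊗ cyclotomic power`.
* `stub_weakExistence_rankOne_normTwist_all` — the closed form registered in the skeleton.

No definitions; std axioms; no named fact.
-/

noncomputable section

set_option linter.dupNamespace false -- project-wide option (lakefile weak.linter.dupNamespace); `Summit.Langlands.Langlands` is the mandated namespace

open scoped MatrixGroups Matrix NumberField Classical Polynomial
open Filter IsDedekindDomain Field Polynomial
open Literature.NumberTheory.Automorphic Literature.NumberTheory.GaloisRepresentations
open Literature.NumberTheory.PAdicHodge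
open Summit.Langlands

namespace Summit.Langlands.Langlands.Theorems.ReciprocityUpToIrreducibility

variable {K : Type} [Field K] [NumberField K] {ℓ : ℕ} [Fact ℓ.Prime]

/-! ## 1. Open kernel ⇒ finite image; the open-kernel avatar of a finite-order Hecke character -/

/-- A Galois representation with open kernel has finite image: `Γ_K` is compact, so the open subgroup
`ker ρ` has finite index and `Γ_K ⧸ ker ρ ≃ range ρ` (private copy of c8's lemma of the same name in
`…ArtinSectorAboveClause`). [cite: SerreAbelianLadic1968, Ch. III §2.3] -/
private theorem finite_range_of_isOpen_ker_aux {A : Type*} [CommRing A] [TopologicalSpace A] {n : ℕ}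
    (ρ : FramedGaloisRep K A n) (hker : IsOpen (ρ.toMonoidHom.ker : Set (absoluteGaloisGroup K))) :
    (Set.range ρ).Finite := by
  haveI : Finite (absoluteGaloisGroup K ⧸ ρ.toMonoidHom.ker) :=
    Subgroup.quotient_finite_of_isOpen _ hker
  haveI : Finite ρ.toMonoidHom.range :=
    Finite.of_equiv _ (QuotientGroup.quotientKerEquivRange ρ.toMonoidHom).toEquiv
  have h : ((ρ.toMonoidHom.range : Subgroup (GL (Fin n) A)) : Set (GL (Fin n) A)).Finite :=
    Set.toFinite _
  rwa [MonoidHom.coe_range] at h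

/-- The restriction to a decomposition group `Γ_{K_v}` of a Galois representation with open kernel
has finite image (`range ρ|_{Γ_{K_v}} ⊆ range ρ`; private copy of c8's lemma of the same name).
[cite: SerreAbelianLadic1968, Ch. III §2.3] -/
private theorem finite_range_toLocal_of_isOpen_ker_aux {A : Type*} [CommRing A] [TopologicalSpace A]
    {n : ℕ} (ρ : FramedGaloisRep K A n)
    (hker : IsOpen (ρ.toMonoidHom.ker : Set (absoluteGaloisGroup K))) (v : HeightOneSpectrum (𝓞 K)) :
    (Set.range (ρ.toLocal v)).Finite :=
  (finite_range_of_isOpen_ker_aux ρ hker).subset <| by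
    rintro _ ⟨σ, rfl⟩
    exact ⟨absGaloisRestrict K (v.adicCompletion K) σ, (FramedGaloisRep.toLocal_apply v ρ σ).symm⟩

/-- **The `ℓ`-adic avatar of a finite-order Hecke character, with open kernel.**  For `χ₀` of finite
order and `ι : ℚ̄_ℓ ≃+* ℂ` there is `r : Γ_K → GL_1(ℚ̄_ℓ)` with OPEN KERNEL, unramified at `v` iff
`χ₀` is, with `char r(Frob_v^{arith}) = X - ι⁻¹(χ₀(ϖ_v))⁻¹` at every such `v`: the avatar
`FramedArtinRep.lAdicAvatar` of the Artin character of `χ₀`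
(`HeckeCharacter.exists_framedArtinRep_of_isFiniteOrder`; the statement of
`HeckeCharacter.exists_lAdic_of_isFiniteOrder` with the open-kernel clause exported).
[cite: SerreAbelianLadic1968, Ch. III §2.3] [cite: CasselsFrohlichANT1967, Ch. VII §5.1 Main Theorem] -/
theorem exists_lAdic_of_isFiniteOrder_isOpen_ker (χ₀ : HeckeCharacter K) (hfin : χ₀.IsFiniteOrder)
    (ι : PadicAlgCl ℓ ≃+* ℂ) :
    ∃ r : FramedGaloisRep K (PadicAlgCl ℓ) 1,
      IsOpen (r.toMonoidHom.ker : Set (absoluteGaloisGroup K)) ∧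
      (∀ v : HeightOneSpectrum (𝓞 K), r.IsUnramifiedAt v ↔ χ₀.IsUnramifiedAt v) ∧
      ∀ v : HeightOneSpectrum (𝓞 K), χ₀.IsUnramifiedAt v →
        r.HasFrobCharpolyAt v (X - C (ι.symm (χ₀.valueAtUniformizer v)⁻¹)) := by
  obtain ⟨ψ, hram, hfrob⟩ := χ₀.exists_framedArtinRep_of_isFiniteOrder hfin
  exact ⟨ψ.lAdicAvatar ι, isOpen_ker_lAdicAvatar ψ ι,
    fun v => (ψ.isUnramifiedAt_lAdicAvatar_iff ι v).trans (hram v),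
    fun v hv => ψ.hasFrobCharpolyAt_lAdicAvatar ι (hfrob v hv)⟩

/-! ## 2. W in rank one on the whole finite-order sector (unconditional) -/

/-- **Stub W (weak existence) for `GL_1`, the WHOLE finite-order sector, unconditionally.**  Let `π`
be a cuspidal automorphic datum of `GL_1(𝔸_K)` transforming by `χ₀ ∘ det` with `χ₀` of finite order
(ANY ramification, in particular above `ℓ`), and `ι : ℚ̄_ℓ ≃+* ℂ`.  Then there is
`ρ : Γ_K → GL_1(ℚ̄_ℓ)` unramified almost everywhere, de Rham at EVERY `v ∣ ℓ` for Fontaine's pinned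
datum, and Satake–Frobenius compatible with `(π, ι)` at all but finitely many places: `ρ` is the
`ℓ`-adic avatar of the Artin character of `χ₀`; it has open kernel, hence finite image on every
decomposition group, hence is de Rham at `v ∣ ℓ`
(`fontainePstAdicCompletion_isDeRhamFramed_of_finite_range`: the period ring of the pinned datum is
`B_dR`).  The Satake computation is c3's (`weakExistence_rankOne_of_isFiniteOrder`, whose hypothesis
"unramified above `ℓ`" is thus removed).
[cite: BuzzardGeeLMS2014, Conj. 3.2.2 (case n = 1)] [cite: SerreAbelianLadic1968, Ch. III §2.3]
[cite: FontaineAsterisque223III, Exp. III §1.5, §3 and Prop. 1.5.2] -/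
theorem weakExistence_rankOne_of_isFiniteOrder_all (hcpt : isCompact_glFiniteIntegralLevel 1 K)
    (π : CuspidalAutomorphicRepData 1 K hcpt) {χ₀ : HeckeCharacter K}
    (hχ : ∀ (g : (AdelicGroupData.gl 1 K).Adelic), ∀ φ ∈ π.1.W,
      rightTranslation (AdelicGroupData.gl 1 K) g φ -
        ((χ₀ (Matrix.GeneralLinearGroup.det g) : ℂˣ) : ℂ) • φ ∈ π.1.W')
    (hfin : χ₀.IsFiniteOrder) (ι : PadicAlgCl ℓ ≃+* ℂ) :
    ∃ ρ : FramedGaloisRep K (PadicAlgCl ℓ) 1,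
      ((∀ᶠ v : HeightOneSpectrum (𝓞 K) in cofinite, ρ.IsUnramifiedAt v) ∧
        ∀ (v : HeightOneSpectrum (𝓞 K)) (hv : ((ℓ : ℕ) : 𝓞 K) ∈ v.asIdeal),
          (fontainePstAdicCompletion v ℓ hv).IsDeRhamFramed (ρ.toLocal v)) ∧
      ∀ᶠ v : HeightOneSpectrum (𝓞 K) in cofinite, SatakeFrobCompatibleAt ι π.1 ρ v := by
  classical
  obtain ⟨r, hker, hram, hfrob⟩ := exists_lAdic_of_isFiniteOrder_isOpen_ker χ₀ hfin ι
  have hunrπ : ∀ᶠ v : HeightOneSpectrum (𝓞 K) in cofinite, π.1.IsUnramifiedAt v :=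
    π.1.hasSatakeParamAt_cofinite_holds
  have key : ∀ᶠ v : HeightOneSpectrum (𝓞 K) in cofinite, SatakeFrobCompatibleAt ι π.1 r v := by
    filter_upwards [hunrπ] with v hv
    obtain ⟨α, hα⟩ := hv
    have hur : χ₀.IsUnramifiedAt v := π.1.isUnramifiedAt_heckeCharacter_glOne hχ hα
    refine ⟨α, hα, (hram v).2 hur, ?_⟩
    obtain ⟨ϖ, hϖ, rfl⟩ := π.1.exists_eq_singleton_of_hasSatakeParamAt_glOne hχ hα
    have hc : ((χ₀ (localUnits v ϖ) : ℂˣ) : ℂ) = χ₀.valueAtUniformizer v := by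
      rw [← HeckeCharacter.localComponent_eq_valueAtUniformizer hur hϖ,
        HeckeCharacter.localComponent_apply]
    rw [arithFrobPolyOfSatake_one, Multiset.map_singleton, Multiset.prod_singleton, hc]
    exact hfrob v hur
  refine ⟨r, ⟨key.mono fun v ⟨_, _, h, _⟩ => h, fun v hv => ?_⟩, key⟩
  -- de Rham above `ℓ`: `r` has finite image on `Γ_{K_v}`
  exact fontainePstAdicCompletion_isDeRhamFramed_of_finite_range v ℓ hv (r.toLocal v)
    (finite_range_toLocal_of_isOpen_ker_aux r hker v)

/-! ## 3. W in rank one for `χ₀ ‖·‖^k`, `χ₀` of finite order with any ramification -/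

/-- **Stub W (weak existence) for `GL_1`, sector "Hecke character `χ₀ ‖·‖^k` with `χ₀` of finite
order (ANY ramification)", given that the cyclotomic character is de Rham for the pinned datum at
each `v ∣ ℓ`** (no `FontaineDatumExists`).  Let `π` be a cuspidal automorphic datum of `GL_1(𝔸_K)`
transforming by `χ ∘ det` with `χ = χ₀ · ‖·‖^k`, `k ∈ ℤ`, `χ₀` of finite order, and let
`ι : ℚ̄_ℓ ≃+* ℂ`.  Then there is `ρ : Γ_K → GL_1(ℚ̄_ℓ)` unramified almost everywhere, de Rham at every
`v ∣ ℓ` for Fontaine's pinned datum, and Satake–Frobenius compatible with `(π, ι)` at all but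
finitely many places: `ρ = r₀ ⊗ ε_ℓ^k`, the (open-kernel) `ℓ`-adic avatar of the Artin character of
`χ₀` twisted by the `k`-th power of the cyclotomic character; above `ℓ`,
`ρ|_{Γ_{K_v}} = r₀|_{Γ_{K_v}} ⊗ ε_{ℓ,v}^k` with `r₀|_{Γ_{K_v}}` of finite image, hence de Rham
(`fontainePstAdicCompletion_isDeRhamFramed_of_finite_range`), and the twist is de Rham by
`PstWeilDeligneData.IsDeRhamFramed.tateTwist`.  (c3's `weakExistence_rankOne_of_isFiniteOrder_normTwist`
without "`χ₀` unramified above `ℓ`" and without `FontaineDatumExists`.)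
[cite: BuzzardGeeLMS2014, Conj. 3.2.2 (case n = 1)] [cite: SerreAbelianLadic1968, Ch. I §1.2 and Ch. III §2.3]
[cite: FontaineAsterisque223III, Exp. III §1.5, §3 and Prop. 1.5.2] -/
theorem weakExistence_rankOne_of_isFiniteOrder_normTwist_all
    (hcpt : isCompact_glFiniteIntegralLevel 1 K) (π : CuspidalAutomorphicRepData 1 K hcpt)
    {χ₀ : HeckeCharacter K} (k : ℤ)
    (hχ : ∀ (g : (AdelicGroupData.gl 1 K).Adelic), ∀ φ ∈ π.1.W,
      rightTranslation (AdelicGroupData.gl 1 K) g φ -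
        (((χ₀ * HeckeCharacter.normCharacter K ^ k) (Matrix.GeneralLinearGroup.det g) : ℂˣ) : ℂ) • φ ∈
          π.1.W')
    (hfin : χ₀.IsFiniteOrder)
    (hcyc : ∀ (v : HeightOneSpectrum (𝓞 K)) (hv : ((ℓ : ℕ) : 𝓞 K) ∈ v.asIdeal),
      (fontainePstAdicCompletion v ℓ hv).IsDeRhamFramed
        (FramedGaloisRep.cyclotomicPadicAlgCl (v.adicCompletion K) ℓ))
    (ι : PadicAlgCl ℓ ≃+* ℂ) :
    ∃ ρ : FramedGaloisRep K (PadicAlgCl ℓ) 1,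
      ((∀ᶠ v : HeightOneSpectrum (𝓞 K) in cofinite, ρ.IsUnramifiedAt v) ∧
        ∀ (v : HeightOneSpectrum (𝓞 K)) (hv : ((ℓ : ℕ) : 𝓞 K) ∈ v.asIdeal),
          (fontainePstAdicCompletion v ℓ hv).IsDeRhamFramed (ρ.toLocal v)) ∧
      ∀ᶠ v : HeightOneSpectrum (𝓞 K) in cofinite, SatakeFrobCompatibleAt ι π.1 ρ v := by
  classical
  obtain ⟨r, hker, hram, hfrob⟩ := exists_lAdic_of_isFiniteOrder_isOpen_ker χ₀ hfin ι
  obtain ⟨ε, hε⟩ := exists_cyclotomicCharacter_padicAlgCl_zpow K ℓ k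
  have hunrπ : ∀ᶠ v : HeightOneSpectrum (𝓞 K) in cofinite, π.1.IsUnramifiedAt v :=
    π.1.hasSatakeParamAt_cofinite_holds
  -- Satake–Frobenius compatibility at the unramified places away from `ℓ` (c3's computation)
  have key : ∀ᶠ v : HeightOneSpectrum (𝓞 K) in cofinite, SatakeFrobCompatibleAt ι π.1 (r.twist ε) v := by
    filter_upwards [hunrπ, FramedGaloisRep.eventually_natCast_not_mem K ℓ] with v hv hvℓ
    obtain ⟨α, hα⟩ := hv
    have hur : (χ₀ * HeckeCharacter.normCharacter K ^ k).IsUnramifiedAt v :=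
      π.1.isUnramifiedAt_heckeCharacter_glOne hχ hα
    have hur₀ : χ₀.IsUnramifiedAt v := fun u => by
      have h1 := hur u
      have h2 := HeckeCharacter.isUnramifiedAt_normCharacter v u
      rw [HeckeCharacter.localComponent_apply] at h1 h2 ⊢
      rw [HeckeCharacter.mul_apply, heckeCharacter_zpow_apply, h2, one_zpow, mul_one] at h1
      exact h1
    refine ⟨α, hα, FramedGaloisRep.isUnramifiedAt_twist ((hram v).2 hur₀)
      (fun 𝔓 h𝔓 σ hσ => eq_one_of_mem_inertia_of_cyclotomic_zpow hε hvℓ h𝔓 hσ), ?_⟩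
    obtain ⟨ϖ, hϖ, rfl⟩ := π.1.exists_eq_singleton_of_hasSatakeParamAt_glOne hχ hα
    have hval : (((χ₀ * HeckeCharacter.normCharacter K ^ k) (localUnits v ϖ) : ℂˣ) : ℂ) =
        χ₀.valueAtUniformizer v * ((v.residueCard : ℂ)⁻¹) ^ k := by
      rw [HeckeCharacter.mul_apply, Units.val_mul, heckeCharacter_zpow_apply,
        Units.val_zpow_eq_zpow_val, ← HeckeCharacter.localComponent_apply,
        ← HeckeCharacter.localComponent_apply,
        HeckeCharacter.localComponent_eq_valueAtUniformizer hur₀ hϖ,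
        HeckeCharacter.localComponent_eq_valueAtUniformizer
          (HeckeCharacter.isUnramifiedAt_normCharacter v) hϖ,
        HeckeCharacter.valueAtUniformizer_normCharacter]
    rw [arithFrobPolyOfSatake_one, Multiset.map_singleton, Multiset.prod_singleton, hval]
    have hroot : ι.symm (χ₀.valueAtUniformizer v * ((v.residueCard : ℂ)⁻¹) ^ k)⁻¹ =
        (v.residueCard : PadicAlgCl ℓ) ^ k * ι.symm (χ₀.valueAtUniformizer v)⁻¹ := by
      rw [mul_inv, inv_zpow, inv_inv, map_mul, map_zpow₀, map_natCast, mul_comm]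
    have h0 : r.HasFrobCharpolyAt v
        (({ι.symm (χ₀.valueAtUniformizer v)⁻¹} : Multiset (PadicAlgCl ℓ)).map fun b => X - C b).prod := by
      rw [Multiset.map_singleton, Multiset.prod_singleton]
      exact hfrob v hur₀
    have htw := FramedGaloisRep.hasFrobCharpolyAt_twist_of_eq_prod h0 (χ := ε)
      (c := (v.residueCard : PadicAlgCl ℓ) ^ k)
      (fun 𝔓 h𝔓 σ hσ => coe_apply_of_isArithFrobAt_of_cyclotomic_zpow hε hvℓ h𝔓 hσ)
    rw [Multiset.map_singleton, Multiset.prod_singleton] at htw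
    rw [hroot]
    exact htw
  refine ⟨r.twist ε, ⟨key.mono fun v ⟨_, _, h, _⟩ => h, fun v hv => ?_⟩, key⟩
  -- de Rham above `ℓ`: `ρ|_{Γ_{K_v}} = r|_{Γ_{K_v}} ⊗ ε_{ℓ,v}^k` with `r|_{Γ_{K_v}}` of finite image
  haveI : NeZero ((ℓ : ℕ) : K) := ⟨Nat.cast_ne_zero.2 (Fact.out : ℓ.Prime).ne_zero⟩
  have hr₀ : (fontainePstAdicCompletion v ℓ hv).IsDeRhamFramed (r.toLocal v) :=
    fontainePstAdicCompletion_isDeRhamFramed_of_finite_range v ℓ hv (r.toLocal v)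
      (finite_range_toLocal_of_isOpen_ker_aux r hker v)
  rw [toLocal_twist]
  refine hr₀.tateTwist (hcyc v hv) k _ fun σ => ?_
  show ((ε (absGaloisRestrict K (v.adicCompletion K) σ) : (PadicAlgCl ℓ)ˣ) : PadicAlgCl ℓ) = _
  rw [hε, cyclotomicCharacter_absGaloisRestrict]

/-- **Closed form of `weakExistence_rankOne_of_isFiniteOrder_normTwist_all`** (all binders explicit, in
the order `K, ℓ, hcpt, π, χ₀, k`; the cyclotomic de Rham-ness at `v ∣ ℓ` as a hypothesis): the shape
in which this sector is registered as a stub of the crux (`stub_weakExistence_rankOne_normTwist_all`,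
wave N10-F). [cite: BuzzardGeeLMS2014, Conj. 3.2.2 (case n = 1)]
[cite: FontaineAsterisque223III, Exp. III §1.5, §3 and Prop. 1.5.2] -/
theorem stub_weakExistence_rankOne_normTwist_all :
    ∀ (K : Type) [Field K] [NumberField K] (ℓ : ℕ) [Fact ℓ.Prime]
      (hcpt : isCompact_glFiniteIntegralLevel 1 K) (π : CuspidalAutomorphicRepData 1 K hcpt)
      (χ₀ : HeckeCharacter K) (k : ℤ),
      (∀ (g : (AdelicGroupData.gl 1 K).Adelic), ∀ φ ∈ π.1.W,
        rightTranslation (AdelicGroupData.gl 1 K) g φ -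
          (((χ₀ * HeckeCharacter.normCharacter K ^ k) (Matrix.GeneralLinearGroup.det g) : ℂˣ) : ℂ) • φ ∈
            π.1.W') →
      χ₀.IsFiniteOrder →
      (∀ (v : HeightOneSpectrum (𝓞 K)) (hv : ((ℓ : ℕ) : 𝓞 K) ∈ v.asIdeal),
        (Literature.NumberTheory.PAdicHodge.fontainePstAdicCompletion v ℓ hv).IsDeRhamFramed
          (FramedGaloisRep.cyclotomicPadicAlgCl (v.adicCompletion K) ℓ)) →
      ∀ ι : PadicAlgCl ℓ ≃+* ℂ,
        ∃ ρ : FramedGaloisRep K (PadicAlgCl ℓ) 1,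
          ((∀ᶠ v : HeightOneSpectrum (𝓞 K) in cofinite, ρ.IsUnramifiedAt v) ∧
            ∀ (v : HeightOneSpectrum (𝓞 K)) (hv : ((ℓ : ℕ) : 𝓞 K) ∈ v.asIdeal),
              (Literature.NumberTheory.PAdicHodge.fontainePstAdicCompletion v ℓ hv).IsDeRhamFramed
                (ρ.toLocal v)) ∧
          ∀ᶠ v : HeightOneSpectrum (𝓞 K) in cofinite, SatakeFrobCompatibleAt ι π.1 ρ v := by
  intro _ _ _ _ _ hcpt π _ k hχ hfin hcyc ι
  exact weakExistence_rankOne_of_isFiniteOrder_normTwist_all hcpt π k hχ hfin hcyc ι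

end Summit.Langlands.Langlands.Theorems.ReciprocityUpToIrreducibility

end
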